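import Literature.Barriers.NavierStokesRegularity.InstantaneousTypeIBlowupDecomposition
import Literature.Analysis.FluidPDE.LacunaryScaleSums
import Mathlib.Analysis.SpecialFunctions.ImproperIntegrals
import Mathlib.Analysis.PSeries
import HarnessLib

/-!
# Cheskidov–Dai–Palasek 2025, Thm. 1.1 (5) / Rmk. 1.3: the Orlicz-in-time bounds of a field
# dominated by a lacunary Gaussian scale sum

Third sibling proof file (all results proved; no definitions, no named facts) of the barrier entry
`Literature/Barriers/NavierStokesRegularity/InstantaneousTypeIBlowup` (A. Cheskidov, M. Dai,
S. Palasek, arXiv:2511.09556 (2025), Thm. 1.1). Hypothesis `h₂` of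
`construction_of_decomposition` (`InstantaneousTypeIBlowupDecomposition`) asks, among the printed
intermediate results about the principal part `v`, for the two Orlicz bounds of Thm. 1.1 (5) with
exponent `c = 2`,

  `∫₀ᵀ F₂(‖v(t)‖_∞) dt < ∞`,  `∫₀ᵀ H₂(‖∇v(t)‖_∞) dt < ∞`,
  `F₂(s) = s²/(1 + (log log(e+s))²)`, `H₂(s) = s/(1 + (log log(e+s))²)`,

for which the paper displays no proof: Rmk. 1.3 attributes them to the lacunary frequency
structure of the principal part ("a more precise version of the Type I bound … reflects the sharp
rate"). The mechanism is the following REAL-VARIABLE fact, proved here. The approximate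
principal part is `v̄(t) = ∑_{j,k} -N_{j,k} e^{-N_{j,k}² t} Δψ_{j,k}` (§3.3) with
`‖∇ⁿψ_{j,k}‖_∞ ≲ N_{j,k}^{n-2}` (Lemma 3.2), so `‖v̄(t)‖_∞ ≲ ∑ₖ N_k e^{-N_k²t}` and
`‖∇v̄(t)‖_∞ ≲ ∑ₖ N_k² e^{-N_k²t}` over the scales `N_k = ⌈A^{b^k}⌉` (§3.1; in `d = 2` the scales
`⌈A^{b^{k+(j-1)/J_d}}⌉`, enumerated increasingly, are of the same double-exponential type), and for
ANY positive sequence of scales with `N_{k+1} ≥ 2N_k` and `N_k ≥ exp(exp(κ(k+1)))`, `κ > 0`,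
every measurable `G ≥ 0` on `(0, T)` obeys

* `integrableOn_orliczF_of_le_tsum_lacunary`: `G(t) ≤ C ∑ₖ N_k e^{-cN_k²t}` implies
  `∫₀ᵀ F₂(G(t)) dt < ∞`;
* `integrableOn_orliczH_of_le_tsum_lacunary`: `G(t) ≤ C ∑ₖ N_k² e^{-cN_k²t}` implies
  `∫₀ᵀ H₂(G(t)) dt < ∞`;

with the instantiations `integrableOn_orliczF_iSup_norm_of_lacunary`,
`integrableOn_orliczH_iSup_norm_fderiv_of_lacunary` for `G = ‖v(t)‖_∞`, `‖∇v(t)‖_∞` of a field on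
`𝕋ⁿ`, in the vocabulary of `h₂`. (Without the weight both integrals DIVERGE: each gap
`I_k = (N_{k+1}^{-2}, N_k^{-2}]` contributes `≍ 1` to `∫ (∑ N_k e^{-N_k²t})² dt`; the weight is
`≲ (κ k)^{-2}` where the integrand is large, and `∑ k^{-2} < ∞` — this is the count of Rmk. 1.3 and
the reason for the exponent `c = 2` chosen in `h₂`.)

Proof (all in this file): tile `(0, N_0^{-2}]` by the gaps `I_k` (`exists_mem_Ioc_of_lacunary`); on
`I_k` split the series at `k`: the head is `≤ ∑_{i≤k} N_i ≤ 2N_k` (resp. `∑_{i≤k} N_i² ≤ 4N_k²/3`),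
the tail is the series of the shifted sequence, bounded by the tree's lacunary Gaussian sum
`Literature.Analysis.FluidPDE.exists_tsum_rpow_mul_exp_neg_le_of_lacunary` (Coiculescu–Palasek
2025, Prop. 3.13 (3.13a)) by `C₁ t^{-1/2} e^{-cN_{k+1}²t/2} ≤ C₁ N_{k+1} e^{-cN_{k+1}²t/2}`
(resp. `C₂ t^{-1} e^{-cN_{k+1}²t/2}`), whence `∫_{I_k} g² ≤ 8 + 2C₁²/c` and `∫_{I_k} g₂ ≤ 4/3 + 2C₂/c`
uniformly in `k` (`lintegral_Ioc_const_add_exp_le`); the threshold bounds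
`F₂(s) ≤ s²/(1 + (log log(e+M))²) + M²`, `H₂(s) ≤ s/(1 + (log log(e+M))²) + M` with `M = √N_k`
(resp. `N_k`) and `1/(1 + (log log(e + √N_k))²) ≤ 2/(κ(k+1))²` then give a summable sequence of
gap contributions, and on `[N_0^{-2}, T)` the integrand is bounded.

## References

* A. Cheskidov, M. Dai, S. Palasek, arXiv:2511.09556 (2025): Thm. 1.1 (5), Rmk. 1.3, §3.1
  (scales), §3.3 (`v̄`), Lemma 3.2, Prop. 4.3. [`CheskidovDaiPalasek2025`]
* M. P. Coiculescu, S. Palasek, Invent. Math. 244 (2025), arXiv:2503.14699: Prop. 3.13 (3.13a)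
  (the lacunary Gaussian sum, vendored in `Literature.Analysis.FluidPDE.LacunaryScaleSums`).
  [`CoiculescuPalasek2025`]
-/

noncomputable section

open MeasureTheory Set Filter Topology
open scoped ENNReal

namespace Literature.Barriers.NavierStokesRegularity

open Literature.Analysis
open Literature.Analysis.FluidPDE (exists_tsum_rpow_mul_exp_neg_le_of_lacunary
  summable_rpow_mul_exp_neg_of_lacunary pow_mul_le_of_lacunary le_of_lacunary)

variable {N : ℕ → ℝ}

/-! ## Lacunary bookkeeping: heads of the series and the growth `N_k ≥ 2^k N_0` -/

section Lacunary

/-- `∑_{i ≤ k} N_i ≤ 2 N_k` for a non-negative sequence with `N_{i+1} ≥ 2N_i`. [folklore] -/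
theorem sum_range_succ_le_two_mul_of_lacunary (hN : ∀ k, 0 ≤ N k)
    (hlac : ∀ k, 2 * N k ≤ N (k + 1)) (k : ℕ) :
    ∑ i ∈ Finset.range (k + 1), N i ≤ 2 * N k := by
  induction k with
  | zero => simp; linarith [hN 0]
  | succ k ih =>
    rw [Finset.sum_range_succ]
    linarith [hlac k]

/-- `∑_{i ≤ k} N_i² ≤ (4/3) N_k²` for a non-negative sequence with `N_{i+1} ≥ 2N_i`. [folklore] -/
theorem sum_range_succ_sq_le_of_lacunary (hN : ∀ k, 0 ≤ N k)
    (hlac : ∀ k, 2 * N k ≤ N (k + 1)) (k : ℕ) :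
    ∑ i ∈ Finset.range (k + 1), N i ^ 2 ≤ 4 / 3 * N k ^ 2 := by
  induction k with
  | zero => simp; nlinarith [sq_nonneg (N 0)]
  | succ k ih =>
    rw [Finset.sum_range_succ]
    have h := hlac k
    have h0 := hN k
    nlinarith

/-- `N_k⁻¹ ≤ N_0⁻¹ 2^{-k}` for a positive sequence with `N_{k+1} ≥ 2N_k`. [folklore] -/
theorem inv_le_of_lacunary (hN : ∀ k, 0 < N k) (hlac : ∀ k, 2 * N k ≤ N (k + 1)) (k : ℕ) :
    (N k)⁻¹ ≤ (N 0)⁻¹ * (1 / 2 : ℝ) ^ k := by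
  have h := pow_mul_le_of_lacunary (by norm_num : (0 : ℝ) ≤ 2) hlac 0 k
  rw [zero_add] at h
  have hN0 := hN 0
  calc (N k)⁻¹ ≤ (2 ^ k * N 0)⁻¹ := inv_anti₀ (by positivity) h
    _ = (N 0)⁻¹ * (1 / 2 : ℝ) ^ k := by rw [mul_inv, ← inv_pow, one_div, mul_comm]

/-- The gaps `I_k = (N_{k+1}^{-2}, N_k^{-2}]` of a positive sequence with `N_{k+1} ≥ 2N_k` cover
`(0, N_0^{-2}]`. [folklore] -/
theorem exists_mem_Ioc_of_lacunary (hN : ∀ k, 0 < N k) (hlac : ∀ k, 2 * N k ≤ N (k + 1))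
    {t : ℝ} (ht : 0 < t) (ht₀ : t ≤ (N 0 ^ 2)⁻¹) :
    ∃ k, t ∈ Ioc (N (k + 1) ^ 2)⁻¹ (N k ^ 2)⁻¹ := by
  classical
  have hN0 := hN 0
  have hex : ∃ k, (N k ^ 2)⁻¹ < t := by
    obtain ⟨n, hn⟩ := pow_unbounded_of_one_lt (t * N 0 ^ 2)⁻¹ (by norm_num : (1 : ℝ) < 4)
    refine ⟨n, ?_⟩
    have hgrow : 2 ^ n * N 0 ≤ N n := by
      have h := pow_mul_le_of_lacunary (by norm_num : (0 : ℝ) ≤ 2) hlac 0 n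
      rwa [zero_add] at h
    have h4 : (4 : ℝ) ^ n * N 0 ^ 2 ≤ N n ^ 2 := by
      have h1 : (2 ^ n * N 0) ^ 2 ≤ N n ^ 2 := pow_le_pow_left₀ (by positivity) hgrow 2
      have h2 : ((2 : ℝ) ^ n) ^ 2 = 4 ^ n := by
        rw [← pow_mul, mul_comm, pow_mul]; norm_num
      calc (4 : ℝ) ^ n * N 0 ^ 2 = (2 ^ n * N 0) ^ 2 := by rw [mul_pow, h2]
        _ ≤ N n ^ 2 := h1
    have hpos : 0 < (4 : ℝ) ^ n * N 0 ^ 2 := by positivity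
    have hn' : ((4 : ℝ) ^ n)⁻¹ < t * N 0 ^ 2 := (inv_lt_comm₀ (by positivity) (by positivity)).1 hn
    calc (N n ^ 2)⁻¹ ≤ ((4 : ℝ) ^ n * N 0 ^ 2)⁻¹ := inv_anti₀ hpos h4
      _ = ((4 : ℝ) ^ n)⁻¹ * (N 0 ^ 2)⁻¹ := mul_inv _ _
      _ < t * N 0 ^ 2 * (N 0 ^ 2)⁻¹ := mul_lt_mul_of_pos_right hn' (by positivity)
      _ = t := by field_simp
  have hm := Nat.find_spec hex
  have hm0 : Nat.find hex ≠ 0 := by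
    intro h0
    rw [h0] at hm
    linarith
  obtain ⟨k, hk⟩ := Nat.exists_eq_succ_of_ne_zero hm0
  refine ⟨k, ?_, ?_⟩
  · rw [hk] at hm
    exact hm
  · have h := Nat.find_min hex (show k < Nat.find hex by omega)
    exact not_lt.1 h

end Lacunary

/-! ## The series on one gap: head `≤ 2N_k` (`4N_k²/3`), tail `≲ N_{k+1} e^{-cN_{k+1}²t/2}` -/

section Gap

/-- **`∑ᵢ N_i e^{-cN_i²t}` on the gap `t > N_{k+1}^{-2}`**: splitting the series at `k`,
`∑ᵢ N_i e^{-cN_i²t} ≤ 2N_k + C₁ N_{k+1} e^{-cN_{k+1}²t/2}`, where `C₁` is the constant of the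
lacunary Gaussian sum `∑ N_k e^{-cN_k²t} ≤ C₁ t^{-1/2} e^{-cN_0²t/2}`
(`exists_tsum_rpow_mul_exp_neg_le_of_lacunary`, applied to the shifted sequence `i ↦ N_{i+k+1}`).
[cite: CheskidovDaiPalasek2025, Rmk. 1.3; §3.3] -/
theorem tsum_mul_exp_neg_le_of_gap (hN : ∀ k, 0 < N k) (hlac : ∀ k, 2 * N k ≤ N (k + 1))
    {c : ℝ} (hc : 0 < c) {C₁ : ℝ} (hC₁0 : 0 ≤ C₁)
    (hC₁ : ∀ N' : ℕ → ℝ, (∀ k, 0 < N' k) → (∀ k, 2 * N' k ≤ N' (k + 1)) → ∀ t : ℝ, 0 < t →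
      ∑' k, N' k ^ (1 : ℝ) * Real.exp (-(c * N' k ^ 2 * t)) ≤
        C₁ * t ^ (-((1 : ℝ) / 2)) * Real.exp (-(c / 2 * N' 0 ^ 2 * t)))
    (k : ℕ) {t : ℝ} (ht : (N (k + 1) ^ 2)⁻¹ < t) :
    ∑' i, N i * Real.exp (-(c * N i ^ 2 * t)) ≤
      2 * N k + C₁ * N (k + 1) * Real.exp (-(c / 2 * N (k + 1) ^ 2 * t)) := by
  have hNk := hN (k + 1)
  have ht0 : 0 < t := lt_trans (by positivity) ht
  have hsum : Summable fun i => N i * Real.exp (-(c * N i ^ 2 * t)) := by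
    have h := summable_rpow_mul_exp_neg_of_lacunary hN hlac one_pos hc ht0
    simp_rw [Real.rpow_one] at h
    exact h
  rw [← hsum.sum_add_tsum_nat_add (k + 1)]
  have hhead : ∑ i ∈ Finset.range (k + 1), N i * Real.exp (-(c * N i ^ 2 * t)) ≤ 2 * N k := by
    calc ∑ i ∈ Finset.range (k + 1), N i * Real.exp (-(c * N i ^ 2 * t))
        ≤ ∑ i ∈ Finset.range (k + 1), N i := Finset.sum_le_sum fun i _ => by
          have hNi := hN i
          have h1 : Real.exp (-(c * N i ^ 2 * t)) ≤ 1 := by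
            rw [Real.exp_le_one_iff, neg_nonpos]; positivity
          calc N i * Real.exp (-(c * N i ^ 2 * t)) ≤ N i * 1 := by gcongr
            _ = N i := mul_one _
      _ ≤ 2 * N k := sum_range_succ_le_two_mul_of_lacunary (fun i => (hN i).le) hlac k
  have htail : ∑' i, N (i + (k + 1)) * Real.exp (-(c * N (i + (k + 1)) ^ 2 * t)) ≤
      C₁ * N (k + 1) * Real.exp (-(c / 2 * N (k + 1) ^ 2 * t)) := by
    have h := hC₁ (fun i => N (i + (k + 1))) (fun i => hN _) (fun i => by
      have h' := hlac (i + (k + 1))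
      rwa [show i + (k + 1) + 1 = i + 1 + (k + 1) by ring] at h') t ht0
    simp_rw [Real.rpow_one] at h
    simp only [zero_add] at h
    refine h.trans ?_
    have h1 : t ^ (-((1 : ℝ) / 2)) ≤ N (k + 1) := by
      rw [Real.rpow_neg ht0.le, ← Real.sqrt_eq_rpow]
      rw [inv_le_comm₀ (Real.sqrt_pos.2 ht0) hNk, Real.le_sqrt' (inv_pos.2 hNk), inv_pow]
      exact ht.le
    have h2 : 0 ≤ Real.exp (-(c / 2 * N (k + 1) ^ 2 * t)) := (Real.exp_pos _).le
    gcongr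
  linarith

/-- **`∑ᵢ N_i² e^{-cN_i²t}` on the gap `t > N_{k+1}^{-2}`**:
`∑ᵢ N_i² e^{-cN_i²t} ≤ (4/3)N_k² + C₂ N_{k+1}² e^{-cN_{k+1}²t/2}`, `C₂` the constant of
`∑ N_k² e^{-cN_k²t} ≤ C₂ t^{-1} e^{-cN_0²t/2}`. [cite: CheskidovDaiPalasek2025, Rmk. 1.3; §3.3] -/
theorem tsum_sq_mul_exp_neg_le_of_gap (hN : ∀ k, 0 < N k) (hlac : ∀ k, 2 * N k ≤ N (k + 1))
    {c : ℝ} (hc : 0 < c) {C₂ : ℝ} (hC₂0 : 0 ≤ C₂)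
    (hC₂ : ∀ N' : ℕ → ℝ, (∀ k, 0 < N' k) → (∀ k, 2 * N' k ≤ N' (k + 1)) → ∀ t : ℝ, 0 < t →
      ∑' k, N' k ^ (2 : ℝ) * Real.exp (-(c * N' k ^ 2 * t)) ≤
        C₂ * t ^ (-((2 : ℝ) / 2)) * Real.exp (-(c / 2 * N' 0 ^ 2 * t)))
    (k : ℕ) {t : ℝ} (ht : (N (k + 1) ^ 2)⁻¹ < t) :
    ∑' i, N i ^ 2 * Real.exp (-(c * N i ^ 2 * t)) ≤
      4 / 3 * N k ^ 2 + C₂ * N (k + 1) ^ 2 * Real.exp (-(c / 2 * N (k + 1) ^ 2 * t)) := by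
  have hNk := hN (k + 1)
  have ht0 : 0 < t := lt_trans (by positivity) ht
  have hsum : Summable fun i => N i ^ 2 * Real.exp (-(c * N i ^ 2 * t)) := by
    have h := summable_rpow_mul_exp_neg_of_lacunary hN hlac two_pos hc ht0
    simp_rw [Real.rpow_two] at h
    exact h
  rw [← hsum.sum_add_tsum_nat_add (k + 1)]
  have hhead : ∑ i ∈ Finset.range (k + 1), N i ^ 2 * Real.exp (-(c * N i ^ 2 * t)) ≤
      4 / 3 * N k ^ 2 := by
    calc ∑ i ∈ Finset.range (k + 1), N i ^ 2 * Real.exp (-(c * N i ^ 2 * t))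
        ≤ ∑ i ∈ Finset.range (k + 1), N i ^ 2 := Finset.sum_le_sum fun i _ => by
          have hNi := hN i
          have h1 : Real.exp (-(c * N i ^ 2 * t)) ≤ 1 := by
            rw [Real.exp_le_one_iff, neg_nonpos]; positivity
          calc N i ^ 2 * Real.exp (-(c * N i ^ 2 * t)) ≤ N i ^ 2 * 1 := by gcongr
            _ = N i ^ 2 := mul_one _
      _ ≤ 4 / 3 * N k ^ 2 := sum_range_succ_sq_le_of_lacunary (fun i => (hN i).le) hlac k
  have htail : ∑' i, N (i + (k + 1)) ^ 2 * Real.exp (-(c * N (i + (k + 1)) ^ 2 * t)) ≤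
      C₂ * N (k + 1) ^ 2 * Real.exp (-(c / 2 * N (k + 1) ^ 2 * t)) := by
    have h := hC₂ (fun i => N (i + (k + 1))) (fun i => hN _) (fun i => by
      have h' := hlac (i + (k + 1))
      rwa [show i + (k + 1) + 1 = i + 1 + (k + 1) by ring] at h') t ht0
    simp_rw [Real.rpow_two] at h
    simp only [zero_add] at h
    refine h.trans ?_
    have h1 : t ^ (-((2 : ℝ) / 2)) ≤ N (k + 1) ^ 2 := by
      rw [show (-((2 : ℝ) / 2)) = -1 by norm_num, Real.rpow_neg_one]
      rw [inv_le_comm₀ ht0 (by positivity)]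
      exact ht.le
    have h2 : 0 ≤ Real.exp (-(c / 2 * N (k + 1) ^ 2 * t)) := (Real.exp_pos _).le
    gcongr
  linarith

end Gap

/-! ## Integrals over one gap -/

section GapIntegral

/-- `∫⁻_{(a,b]} e^{-γt} dt ≤ e^{-γa}/γ` for `γ > 0`. [folklore] -/
theorem lintegral_Ioc_exp_neg_le {a b γ : ℝ} (hγ : 0 < γ) :
    ∫⁻ t in Ioc a b, ENNReal.ofReal (Real.exp (-(γ * t))) ≤
      ENNReal.ofReal (Real.exp (-(γ * a)) / γ) := by
  have hγ' : -γ < 0 := neg_lt_zero.2 hγ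
  have hfun : (fun t : ℝ => Real.exp (-(γ * t))) = fun t => Real.exp (-γ * t) := by
    ext t; ring_nf
  calc ∫⁻ t in Ioc a b, ENNReal.ofReal (Real.exp (-(γ * t)))
      ≤ ∫⁻ t in Ioi a, ENNReal.ofReal (Real.exp (-(γ * t))) := lintegral_mono_set Ioc_subset_Ioi_self
    _ = ENNReal.ofReal (∫ t in Ioi a, Real.exp (-(γ * t))) := by
        rw [ofReal_integral_eq_lintegral_ofReal]
        · rw [hfun]
          exact integrableOn_exp_mul_Ioi hγ' a
        · exact ae_of_all _ fun t => (Real.exp_pos _).le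
    _ = ENNReal.ofReal (Real.exp (-(γ * a)) / γ) := by
        rw [hfun, integral_exp_mul_Ioi hγ' a]
        congr 1
        rw [neg_div, div_neg, neg_neg, neg_mul]

/-- **The gap integral**: for `N_k, N_{k+1} > 0`, `α, β ≥ 0`, `γ > 0`,
`∫⁻_{I_k} (α N_k² + β N_{k+1}² e^{-γ N_{k+1}² t}) dt ≤ α + β/γ` on `I_k = (N_{k+1}^{-2}, N_k^{-2}]`
(`|I_k| ≤ N_k^{-2}` and `∫_{N_{k+1}^{-2}}^∞ N_{k+1}² e^{-γN_{k+1}²t} dt ≤ 1/γ`). [folklore] -/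
theorem lintegral_Ioc_const_add_exp_le {M M' α β γ : ℝ} (hM : 0 < M) (hM' : 0 < M')
    (hα : 0 ≤ α) (hβ : 0 ≤ β) (hγ : 0 < γ) :
    ∫⁻ t in Ioc (M' ^ 2)⁻¹ (M ^ 2)⁻¹,
        ENNReal.ofReal (α * M ^ 2 + β * M' ^ 2 * Real.exp (-(γ * M' ^ 2 * t))) ≤
      ENNReal.ofReal (α + β / γ) := by
  set I : Set ℝ := Ioc (M' ^ 2)⁻¹ (M ^ 2)⁻¹ with hI
  have hsplit : ∀ t, ENNReal.ofReal (α * M ^ 2 + β * M' ^ 2 * Real.exp (-(γ * M' ^ 2 * t))) =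
      ENNReal.ofReal (α * M ^ 2) +
        ENNReal.ofReal (β * M' ^ 2) * ENNReal.ofReal (Real.exp (-(γ * M' ^ 2 * t))) := by
    intro t
    rw [← ENNReal.ofReal_mul (by positivity), ENNReal.ofReal_add (by positivity) (by positivity)]
  simp_rw [hsplit]
  have hmeas : Measurable fun t : ℝ => ENNReal.ofReal (Real.exp (-(γ * M' ^ 2 * t))) :=
    ENNReal.measurable_ofReal.comp (Real.continuous_exp.measurable.comp (by fun_prop))
  rw [lintegral_add_left measurable_const, lintegral_const_mul _ hmeas, setLIntegral_const]
  have hvol : volume I ≤ ENNReal.ofReal ((M ^ 2)⁻¹) := by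
    rw [hI, Real.volume_Ioc]
    exact ENNReal.ofReal_le_ofReal (by linarith [inv_pos.2 (pow_pos hM' 2)])
  have hA : ENNReal.ofReal (α * M ^ 2) * volume I ≤ ENNReal.ofReal α := by
    calc ENNReal.ofReal (α * M ^ 2) * volume I
        ≤ ENNReal.ofReal (α * M ^ 2) * ENNReal.ofReal ((M ^ 2)⁻¹) := by gcongr
      _ = ENNReal.ofReal (α * M ^ 2 * (M ^ 2)⁻¹) := (ENNReal.ofReal_mul (by positivity)).symm
      _ = ENNReal.ofReal α := by rw [mul_inv_cancel_right₀ (pow_pos hM 2).ne']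
  have hB : ENNReal.ofReal (β * M' ^ 2) *
      ∫⁻ t in I, ENNReal.ofReal (Real.exp (-(γ * M' ^ 2 * t))) ≤ ENNReal.ofReal (β / γ) := by
    have hγ' : 0 < γ * M' ^ 2 := by positivity
    have h1 : ∫⁻ t in I, ENNReal.ofReal (Real.exp (-(γ * M' ^ 2 * t))) ≤
        ENNReal.ofReal (1 / (γ * M' ^ 2)) := by
      refine (lintegral_Ioc_exp_neg_le hγ').trans (ENNReal.ofReal_le_ofReal ?_)
      refine div_le_div_of_nonneg_right ?_ hγ'.le
      rw [Real.exp_le_one_iff, neg_nonpos]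
      positivity
    calc ENNReal.ofReal (β * M' ^ 2) * ∫⁻ t in I, ENNReal.ofReal (Real.exp (-(γ * M' ^ 2 * t)))
        ≤ ENNReal.ofReal (β * M' ^ 2) * ENNReal.ofReal (1 / (γ * M' ^ 2)) := by gcongr
      _ = ENNReal.ofReal (β * M' ^ 2 * (1 / (γ * M' ^ 2))) := (ENNReal.ofReal_mul (by positivity)).symm
      _ = ENNReal.ofReal (β / γ) := by
          congr 1
          field_simp
  calc ENNReal.ofReal (α * M ^ 2) * volume I +
        ENNReal.ofReal (β * M' ^ 2) * ∫⁻ t in I, ENNReal.ofReal (Real.exp (-(γ * M' ^ 2 * t)))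
      ≤ ENNReal.ofReal α + ENNReal.ofReal (β / γ) := add_le_add hA hB
    _ = ENNReal.ofReal (α + β / γ) := (ENNReal.ofReal_add hα (by positivity)).symm

end GapIntegral

/-! ## The Orlicz weights: threshold bounds and the size of the weight at the scales -/

section Weights

/-- **Threshold bound for `F₂`**: for `s, M ≥ 0`,
`s²/(1 + (log log(e+s))²) ≤ s²/(1 + (log log(e+M))²) + M²` (if `s ≤ M` the left side is `≤ s² ≤ M²`;
otherwise the weight is smaller at `s` than at `M`). [folklore] -/
theorem orliczF_le_threshold {s M : ℝ} (hs : 0 ≤ s) (hM : 0 ≤ M) :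
    s ^ 2 / (1 + Real.log (Real.log (Real.exp 1 + s)) ^ 2) ≤
      s ^ 2 / (1 + Real.log (Real.log (Real.exp 1 + M)) ^ 2) + M ^ 2 := by
  have h0 : 0 ≤ s ^ 2 / (1 + Real.log (Real.log (Real.exp 1 + M)) ^ 2) := by positivity
  rcases le_or_gt s M with hsM | hMs
  · have h1 : s ^ 2 / (1 + Real.log (Real.log (Real.exp 1 + s)) ^ 2) ≤ s ^ 2 :=
      div_le_self (sq_nonneg s) (by nlinarith [sq_nonneg (Real.log (Real.log (Real.exp 1 + s)))])
    have h2 : s ^ 2 ≤ M ^ 2 := pow_le_pow_left₀ hs hsM 2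
    linarith
  · have hLL : Real.log (Real.log (Real.exp 1 + M)) ≤ Real.log (Real.log (Real.exp 1 + s)) :=
      loglog_mono hM hMs.le
    have hLL0 : 0 ≤ Real.log (Real.log (Real.exp 1 + M)) := loglog_nonneg hM
    have h1 : s ^ 2 / (1 + Real.log (Real.log (Real.exp 1 + s)) ^ 2) ≤
        s ^ 2 / (1 + Real.log (Real.log (Real.exp 1 + M)) ^ 2) := by
      apply div_le_div_of_nonneg_left (sq_nonneg s) (by positivity)
      nlinarith
    nlinarith [sq_nonneg M]

/-- **Threshold bound for `H₂`**: for `s, M ≥ 0`,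
`s/(1 + (log log(e+s))²) ≤ s/(1 + (log log(e+M))²) + M`. [folklore] -/
theorem orliczH_le_threshold {s M : ℝ} (hs : 0 ≤ s) (hM : 0 ≤ M) :
    s / (1 + Real.log (Real.log (Real.exp 1 + s)) ^ 2) ≤
      s / (1 + Real.log (Real.log (Real.exp 1 + M)) ^ 2) + M := by
  have h0 : 0 ≤ s / (1 + Real.log (Real.log (Real.exp 1 + M)) ^ 2) := by positivity
  rcases le_or_gt s M with hsM | hMs
  · have h1 : s / (1 + Real.log (Real.log (Real.exp 1 + s)) ^ 2) ≤ s :=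
      div_le_self hs (by nlinarith [sq_nonneg (Real.log (Real.log (Real.exp 1 + s)))])
    linarith
  · have hLL : Real.log (Real.log (Real.exp 1 + M)) ≤ Real.log (Real.log (Real.exp 1 + s)) :=
      loglog_mono hM hMs.le
    have hLL0 : 0 ≤ Real.log (Real.log (Real.exp 1 + M)) := loglog_nonneg hM
    have h1 : s / (1 + Real.log (Real.log (Real.exp 1 + s)) ^ 2) ≤
        s / (1 + Real.log (Real.log (Real.exp 1 + M)) ^ 2) := by
      apply div_le_div_of_nonneg_left hs (by positivity)
      nlinarith
    linarith

/-- **The weight at a double-exponentially large threshold**: if `M ≥ exp(exp x)`, `x > 0`, then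
`1/(1 + (log log(e+M))²) ≤ 1/x²`. [folklore] -/
theorem inv_orliczDen_le_of_exp_exp_le {x M : ℝ} (hx : 0 < x) (hM : Real.exp (Real.exp x) ≤ M) :
    1 / (1 + Real.log (Real.log (Real.exp 1 + M)) ^ 2) ≤ 1 / x ^ 2 := by
  have hM0 : 0 < M := (Real.exp_pos _).trans_le hM
  have hlogM : Real.exp x ≤ Real.log M := by
    rw [Real.le_log_iff_exp_le hM0]; exact hM
  have h1 : Real.exp x ≤ Real.log (Real.exp 1 + M) :=
    hlogM.trans (Real.log_le_log hM0 (by linarith [Real.exp_pos 1]))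
  have h2 : x ≤ Real.log (Real.log (Real.exp 1 + M)) := by
    rw [← Real.log_exp x]; exact Real.log_le_log (Real.exp_pos x) h1
  have h3 : x ^ 2 ≤ Real.log (Real.log (Real.exp 1 + M)) ^ 2 := pow_le_pow_left₀ hx.le h2 2
  exact one_div_le_one_div_of_le (by positivity) (by linarith)

/-- **The weight at the square root of a double-exponentially large threshold**: if
`M ≥ exp(exp x)`, `x > 0`, then `1/(1 + (log log(e+√M))²) ≤ 2/x²`
(`log log √M = log log M - log 2 ≥ x - log 2`, and `x² ≤ 2 + 2(x - log 2)²` as `log 2 < 1`). [folklore] -/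
theorem inv_orliczDen_sqrt_le_of_exp_exp_le {x M : ℝ} (hx : 0 < x)
    (hM : Real.exp (Real.exp x) ≤ M) :
    1 / (1 + Real.log (Real.log (Real.exp 1 + Real.sqrt M)) ^ 2) ≤ 2 / x ^ 2 := by
  have hM0 : 0 < M := (Real.exp_pos _).trans_le hM
  have hlogM : Real.exp x ≤ Real.log M := by
    rw [Real.le_log_iff_exp_le hM0]; exact hM
  have h1 : Real.exp x / 2 ≤ Real.log (Real.exp 1 + Real.sqrt M) := by
    calc Real.exp x / 2 ≤ Real.log M / 2 := by linarith
      _ = Real.log (Real.sqrt M) := by rw [Real.log_sqrt hM0.le]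
      _ ≤ Real.log (Real.exp 1 + Real.sqrt M) :=
          Real.log_le_log (Real.sqrt_pos.2 hM0) (by linarith [Real.exp_pos 1])
  have h2 : x - Real.log 2 ≤ Real.log (Real.log (Real.exp 1 + Real.sqrt M)) := by
    have h3 : Real.log (Real.exp x / 2) = x - Real.log 2 := by
      rw [Real.log_div (Real.exp_pos x).ne' two_ne_zero, Real.log_exp]
    rw [← h3]
    exact Real.log_le_log (by positivity) h1
  set L := Real.log (Real.log (Real.exp 1 + Real.sqrt M)) with hL
  have hlog2 : Real.log 2 < 1 := by
    have := Real.log_two_lt_d9; linarith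
  have hlog2pos : 0 < Real.log 2 := Real.log_pos one_lt_two
  rw [div_le_div_iff₀ (by positivity) (by positivity), one_mul]
  rcases le_or_gt x (Real.log 2) with hxl | hxl
  · nlinarith [sq_nonneg L]
  · have h4 : 0 ≤ L - (x - Real.log 2) := sub_nonneg.2 h2
    have h5 : 0 ≤ L + (x - Real.log 2) := by linarith
    nlinarith [mul_nonneg h4 h5, sq_nonneg (x - 2 * Real.log 2)]

end Weights

/-! ## The two Orlicz integrability theorems -/

section Main

/-- **Thm. 1.1 (5), first bound, for a field dominated by a lacunary Gaussian scale sum.** Let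
`N_k > 0` with `N_{k+1} ≥ 2N_k` and `N_k ≥ exp(exp(κ(k+1)))` (`κ > 0`), `c > 0`, and let `G` be
measurable on `(0, T)` with `0 ≤ G(t) ≤ C ∑ₖ N_k e^{-cN_k²t}` there. Then
`∫₀ᵀ G(t)²/(1 + (log log(e + G(t)))²) dt < ∞`.
[cite: CheskidovDaiPalasek2025, Thm. 1.1 (5) with Rmk. 1.3 (the bound for `‖u(t)‖_∞`, `c = 2`)] -/
theorem integrableOn_orliczF_of_le_tsum_lacunary (hN : ∀ k, 0 < N k)
    (hlac : ∀ k, 2 * N k ≤ N (k + 1)) {κ : ℝ} (hκ : 0 < κ)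
    (hgrow : ∀ k : ℕ, Real.exp (Real.exp (κ * (k + 1))) ≤ N k) {c : ℝ} (hc : 0 < c) {C T : ℝ}
    {G : ℝ → ℝ} (hGm : AEStronglyMeasurable G (volume.restrict (Ioo 0 T)))
    (hG0 : ∀ t ∈ Ioo 0 T, 0 ≤ G t)
    (hG : ∀ t ∈ Ioo 0 T, G t ≤ C * ∑' k, N k * Real.exp (-(c * N k ^ 2 * t))) :
    IntegrableOn (fun t => G t ^ 2 / (1 + Real.log (Real.log (Real.exp 1 + G t)) ^ (2 : ℝ)))
      (Ioo 0 T) := by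
  simp_rw [Real.rpow_two]
  obtain ⟨C₁, hC₁0, hC₁⟩ := exists_tsum_rpow_mul_exp_neg_le_of_lacunary (a := 1) one_pos hc
  set C' : ℝ := max C 0 with hC'
  have hC'0 : 0 ≤ C' := le_max_right _ _
  -- the series and its domination of `G`
  set g : ℝ → ℝ := fun t => ∑' k, N k * Real.exp (-(c * N k ^ 2 * t)) with hg
  have hg0 : ∀ t, 0 ≤ g t := fun t => tsum_nonneg fun k => by have := hN k; positivity
  have hGle : ∀ t ∈ Ioo 0 T, G t ≤ C' * g t := fun t ht =>
    (hG t ht).trans (mul_le_mul_of_nonneg_right (le_max_left _ _) (hg0 t))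
  have hgT : ∀ t, 0 < t → g t ≤ C₁ * t ^ (-((1 : ℝ) / 2)) := by
    intro t ht
    have h := hC₁ N hN hlac t ht
    simp_rw [Real.rpow_one] at h
    refine h.trans ?_
    have h1 : Real.exp (-(c / 2 * N 0 ^ 2 * t)) ≤ 1 := by
      rw [Real.exp_le_one_iff, neg_nonpos]; have := hN 0; positivity
    calc C₁ * t ^ (-((1 : ℝ) / 2)) * Real.exp (-(c / 2 * N 0 ^ 2 * t))
        ≤ C₁ * t ^ (-((1 : ℝ) / 2)) * 1 := by gcongr
      _ = C₁ * t ^ (-((1 : ℝ) / 2)) := mul_one _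
  -- the integrand
  set Φ : ℝ → ℝ := fun t => G t ^ 2 / (1 + Real.log (Real.log (Real.exp 1 + G t)) ^ 2) with hΦ
  have hΦ0 : ∀ t, 0 ≤ Φ t := fun t => by positivity
  have hΦm : AEStronglyMeasurable Φ (volume.restrict (Ioo 0 T)) := by
    have hφ : Measurable fun s : ℝ => s ^ 2 / (1 + Real.log (Real.log (Real.exp 1 + s)) ^ 2) := by
      fun_prop
    exact (hφ.comp_aemeasurable hGm.aemeasurable).aestronglyMeasurable
  refine ⟨hΦm, ?_⟩
  show ∫⁻ t, ‖Φ t‖ₑ ∂(volume.restrict (Ioo 0 T)) < ∞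
  -- the gaps and the weights at the scales
  set I : ℕ → Set ℝ := fun k => Ioc (N (k + 1) ^ 2)⁻¹ (N k ^ 2)⁻¹ with hI
  set t₀ : ℝ := (N 0 ^ 2)⁻¹ with ht₀
  have ht₀0 : 0 < t₀ := by have := hN 0; positivity
  set w : ℕ → ℝ := fun k => 1 / (1 + Real.log (Real.log (Real.exp 1 + Real.sqrt (N k))) ^ 2)
    with hw
  have hw0 : ∀ k, 0 ≤ w k := fun k => by positivity
  have hwle : ∀ k : ℕ, w k ≤ 2 / κ ^ 2 * (1 / ((k : ℝ) + 1) ^ 2) := by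
    intro k
    have h := inv_orliczDen_sqrt_le_of_exp_exp_le (by positivity : 0 < κ * (k + 1)) (hgrow k)
    calc w k ≤ 2 / (κ * (k + 1)) ^ 2 := h
      _ = 2 / κ ^ 2 * (1 / ((k : ℝ) + 1) ^ 2) := by
          field_simp
  -- the gap contributions `b k`
  set K : ℝ := C' ^ 2 * (8 + 2 * C₁ ^ 2 / c) with hK
  have hK0 : 0 ≤ K := by positivity
  set b : ℕ → ℝ := fun k => w k * K + (N k)⁻¹ with hb
  have hb0 : ∀ k, 0 ≤ b k := fun k => by have := hN k; positivity
  have hbsum : Summable b := by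
    -- `∑ 1/(k+1)² < ∞` (the count of Rmk. 1.3) and `∑ N_k⁻¹ ≤ N_0⁻¹ ∑ 2^{-k} < ∞`
    have hs2 : Summable fun k : ℕ => 1 / ((k : ℝ) + 1) ^ 2 := by
      have h := (summable_nat_add_iff 1).mpr (Real.summable_one_div_nat_pow.mpr one_lt_two)
      simpa [Nat.cast_add, Nat.cast_one] using h
    have h1 : Summable fun k : ℕ =>
        2 / κ ^ 2 * (1 / ((k : ℝ) + 1) ^ 2) * K + (N 0)⁻¹ * (1 / 2 : ℝ) ^ k :=
      ((hs2.mul_left _).mul_right _).add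
        ((summable_geometric_of_lt_one (by norm_num) (by norm_num)).mul_left _)
    refine Summable.of_nonneg_of_le hb0 (fun k => ?_) h1
    exact add_le_add (mul_le_mul_of_nonneg_right (hwle k) hK0) (inv_le_of_lacunary hN hlac k)
  -- pointwise bound on a gap
  have hpt : ∀ k, ∀ t ∈ I k ∩ Ioo 0 T, ‖Φ t‖ₑ ≤
      ENNReal.ofReal ((8 * w k * C' ^ 2 + (N k)⁻¹) * N k ^ 2 +
        2 * w k * C' ^ 2 * C₁ ^ 2 * N (k + 1) ^ 2 * Real.exp (-(c * N (k + 1) ^ 2 * t))) := by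
    intro k t ht
    have hNk := hN k
    have hNk1 := hN (k + 1)
    have ht0 : 0 < t := ht.2.1
    rw [Real.enorm_eq_ofReal (hΦ0 t)]
    refine ENNReal.ofReal_le_ofReal ?_
    have hGt := hG0 t ht.2
    set E : ℝ := Real.exp (-(c / 2 * N (k + 1) ^ 2 * t)) with hE
    have hE0 : 0 ≤ E := (Real.exp_pos _).le
    have hE2 : E ^ 2 = Real.exp (-(c * N (k + 1) ^ 2 * t)) := by
      rw [hE, sq, ← Real.exp_add]; ring_nf
    have hgt : g t ≤ 2 * N k + C₁ * N (k + 1) * E :=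
      tsum_mul_exp_neg_le_of_gap hN hlac hc hC₁0.le hC₁ k ht.1.1
    have hGg : G t ≤ C' * g t := hGle t ht.2
    have h1 : Φ t ≤ w k * G t ^ 2 + N k := by
      have h := orliczF_le_threshold hGt (Real.sqrt_nonneg (N k))
      rw [Real.sq_sqrt hNk.le] at h
      simpa [hΦ, hw, one_div, div_eq_inv_mul, mul_comm] using h
    have h2 : G t ^ 2 ≤ C' ^ 2 * (8 * N k ^ 2 + 2 * C₁ ^ 2 * N (k + 1) ^ 2 * E ^ 2) := by
      have h3 : G t ≤ C' * (2 * N k + C₁ * N (k + 1) * E) :=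
        hGg.trans (mul_le_mul_of_nonneg_left hgt hC'0)
      have h4 : G t ^ 2 ≤ (C' * (2 * N k + C₁ * N (k + 1) * E)) ^ 2 := pow_le_pow_left₀ hGt h3 2
      have h5 : (2 * N k + C₁ * N (k + 1) * E) ^ 2 ≤
          8 * N k ^ 2 + 2 * C₁ ^ 2 * N (k + 1) ^ 2 * E ^ 2 := by
        nlinarith [sq_nonneg (2 * N k - C₁ * N (k + 1) * E)]
      calc G t ^ 2 ≤ (C' * (2 * N k + C₁ * N (k + 1) * E)) ^ 2 := h4
        _ = C' ^ 2 * (2 * N k + C₁ * N (k + 1) * E) ^ 2 := by ring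
        _ ≤ C' ^ 2 * (8 * N k ^ 2 + 2 * C₁ ^ 2 * N (k + 1) ^ 2 * E ^ 2) := by gcongr
    have hwk := hw0 k
    calc Φ t ≤ w k * G t ^ 2 + N k := h1
      _ ≤ w k * (C' ^ 2 * (8 * N k ^ 2 + 2 * C₁ ^ 2 * N (k + 1) ^ 2 * E ^ 2)) + N k := by gcongr
      _ = (8 * w k * C' ^ 2 + (N k)⁻¹) * N k ^ 2 +
          2 * w k * C' ^ 2 * C₁ ^ 2 * N (k + 1) ^ 2 * Real.exp (-(c * N (k + 1) ^ 2 * t)) := by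
          rw [← hE2]; field_simp; ring
  -- the gap integrals
  have hk : ∀ k, ∫⁻ t in I k ∩ Ioo 0 T, ‖Φ t‖ₑ ≤ ENNReal.ofReal (b k) := by
    intro k
    have hNk := hN k
    have hNk1 := hN (k + 1)
    have hwk := hw0 k
    calc ∫⁻ t in I k ∩ Ioo 0 T, ‖Φ t‖ₑ
        ≤ ∫⁻ t in I k ∩ Ioo 0 T, ENNReal.ofReal ((8 * w k * C' ^ 2 + (N k)⁻¹) * N k ^ 2 +
            2 * w k * C' ^ 2 * C₁ ^ 2 * N (k + 1) ^ 2 * Real.exp (-(c * N (k + 1) ^ 2 * t))) :=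
          setLIntegral_mono' (measurableSet_Ioc.inter measurableSet_Ioo) (hpt k)
      _ ≤ ∫⁻ t in I k, ENNReal.ofReal ((8 * w k * C' ^ 2 + (N k)⁻¹) * N k ^ 2 +
            2 * w k * C' ^ 2 * C₁ ^ 2 * N (k + 1) ^ 2 * Real.exp (-(c * N (k + 1) ^ 2 * t))) :=
          lintegral_mono_set inter_subset_left
      _ ≤ ENNReal.ofReal ((8 * w k * C' ^ 2 + (N k)⁻¹) + 2 * w k * C' ^ 2 * C₁ ^ 2 / c) :=
          lintegral_Ioc_const_add_exp_le hNk hNk1 (by positivity) (by positivity) hc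
      _ = ENNReal.ofReal (b k) := by
          congr 1
          simp only [hb, hK]
          ring
  -- the bounded piece `[t₀, T)`
  set B : ℝ := (C' * (C₁ * t₀ ^ (-((1 : ℝ) / 2)))) ^ 2 with hB
  have htail : ∫⁻ t in Ioi t₀ ∩ Ioo 0 T, ‖Φ t‖ₑ ≤ ENNReal.ofReal B * volume (Ioo 0 T) := by
    have h1 : ∀ t ∈ Ioi t₀ ∩ Ioo 0 T, ‖Φ t‖ₑ ≤ ENNReal.ofReal B := by
      intro t ht
      have ht0 : 0 < t := ht.2.1
      rw [Real.enorm_eq_ofReal (hΦ0 t)]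
      refine ENNReal.ofReal_le_ofReal ?_
      have hGt := hG0 t ht.2
      have h2 : G t ≤ C' * (C₁ * t₀ ^ (-((1 : ℝ) / 2))) := by
        refine (hGle t ht.2).trans (mul_le_mul_of_nonneg_left ?_ hC'0)
        refine (hgT t ht0).trans (mul_le_mul_of_nonneg_left ?_ hC₁0.le)
        exact Real.rpow_le_rpow_of_nonpos ht₀0 (le_of_lt ht.1) (by norm_num)
      have h3 : Φ t ≤ G t ^ 2 :=
        div_le_self (sq_nonneg _) (by nlinarith [sq_nonneg (Real.log (Real.log (Real.exp 1 + G t)))])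
      exact h3.trans (pow_le_pow_left₀ hGt h2 2)
    calc ∫⁻ t in Ioi t₀ ∩ Ioo 0 T, ‖Φ t‖ₑ ≤ ∫⁻ t in Ioi t₀ ∩ Ioo 0 T, ENNReal.ofReal B :=
          setLIntegral_mono' (measurableSet_Ioi.inter measurableSet_Ioo) h1
      _ = ENNReal.ofReal B * volume (Ioi t₀ ∩ Ioo 0 T) := setLIntegral_const _ _
      _ ≤ ENNReal.ofReal B * volume (Ioo 0 T) := by gcongr; exact inter_subset_right
  -- the cover
  have hcover : Ioo 0 T ⊆ (⋃ k, I k ∩ Ioo 0 T) ∪ (Ioi t₀ ∩ Ioo 0 T) := by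
    intro t ht
    rcases le_or_gt t t₀ with h | h
    · obtain ⟨k, hk'⟩ := exists_mem_Ioc_of_lacunary hN hlac ht.1 h
      exact Or.inl (mem_iUnion.2 ⟨k, hk', ht⟩)
    · exact Or.inr ⟨h, ht⟩
  calc ∫⁻ t in Ioo 0 T, ‖Φ t‖ₑ
      ≤ ∫⁻ t in (⋃ k, I k ∩ Ioo 0 T) ∪ (Ioi t₀ ∩ Ioo 0 T), ‖Φ t‖ₑ := lintegral_mono_set hcover
    _ ≤ (∫⁻ t in ⋃ k, I k ∩ Ioo 0 T, ‖Φ t‖ₑ) + ∫⁻ t in Ioi t₀ ∩ Ioo 0 T, ‖Φ t‖ₑ :=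
        lintegral_union_le _ _ _
    _ ≤ (∑' k, ∫⁻ t in I k ∩ Ioo 0 T, ‖Φ t‖ₑ) + ∫⁻ t in Ioi t₀ ∩ Ioo 0 T, ‖Φ t‖ₑ := by
        gcongr
        exact lintegral_iUnion_le _ _
    _ ≤ (∑' k, ENNReal.ofReal (b k)) + ENNReal.ofReal B * volume (Ioo 0 T) :=
        add_le_add (ENNReal.tsum_le_tsum hk) htail
    _ < ∞ := by
        rw [← ENNReal.ofReal_tsum_of_nonneg hb0 hbsum]
        refine ENNReal.add_lt_top.2 ⟨ENNReal.ofReal_lt_top, ?_⟩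
        exact ENNReal.mul_lt_top ENNReal.ofReal_lt_top (by simp [Real.volume_Ioo])

/-- **Thm. 1.1 (5), second bound, for a field dominated by a lacunary Gaussian scale sum.**
Let `N_k > 0` with `N_{k+1} ≥ 2N_k` and `N_k ≥ exp(exp(κ(k+1)))` (`κ > 0`), `c > 0`, and let `G`
be measurable on `(0, T)` with `0 ≤ G(t) ≤ C ∑ₖ N_k² e^{-cN_k²t}` there. Then
`∫₀ᵀ G(t)/(1 + (log log(e + G(t)))²) dt < ∞`.
[cite: CheskidovDaiPalasek2025, Thm. 1.1 (5) with Rmk. 1.3 (the bound for `‖∇u(t)‖_∞`, `c = 2`)] -/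
theorem integrableOn_orliczH_of_le_tsum_lacunary (hN : ∀ k, 0 < N k)
    (hlac : ∀ k, 2 * N k ≤ N (k + 1)) {κ : ℝ} (hκ : 0 < κ)
    (hgrow : ∀ k : ℕ, Real.exp (Real.exp (κ * (k + 1))) ≤ N k) {c : ℝ} (hc : 0 < c) {C T : ℝ}
    {G : ℝ → ℝ} (hGm : AEStronglyMeasurable G (volume.restrict (Ioo 0 T)))
    (hG0 : ∀ t ∈ Ioo 0 T, 0 ≤ G t)
    (hG : ∀ t ∈ Ioo 0 T, G t ≤ C * ∑' k, N k ^ 2 * Real.exp (-(c * N k ^ 2 * t))) :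
    IntegrableOn (fun t => G t / (1 + Real.log (Real.log (Real.exp 1 + G t)) ^ (2 : ℝ)))
      (Ioo 0 T) := by
  simp_rw [Real.rpow_two]
  obtain ⟨C₂, hC₂0, hC₂⟩ := exists_tsum_rpow_mul_exp_neg_le_of_lacunary (a := 2) two_pos hc
  set C' : ℝ := max C 0 with hC'
  have hC'0 : 0 ≤ C' := le_max_right _ _
  -- the series and its domination of `G`
  set g : ℝ → ℝ := fun t => ∑' k, N k ^ 2 * Real.exp (-(c * N k ^ 2 * t)) with hg
  have hg0 : ∀ t, 0 ≤ g t := fun t => tsum_nonneg fun k => by have := hN k; positivity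
  have hGle : ∀ t ∈ Ioo 0 T, G t ≤ C' * g t := fun t ht =>
    (hG t ht).trans (mul_le_mul_of_nonneg_right (le_max_left _ _) (hg0 t))
  have hgT : ∀ t, 0 < t → g t ≤ C₂ * t ^ (-((2 : ℝ) / 2)) := by
    intro t ht
    have h := hC₂ N hN hlac t ht
    simp_rw [Real.rpow_two] at h
    refine h.trans ?_
    have h1 : Real.exp (-(c / 2 * N 0 ^ 2 * t)) ≤ 1 := by
      rw [Real.exp_le_one_iff, neg_nonpos]; have := hN 0; positivity
    calc C₂ * t ^ (-((2 : ℝ) / 2)) * Real.exp (-(c / 2 * N 0 ^ 2 * t))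
        ≤ C₂ * t ^ (-((2 : ℝ) / 2)) * 1 := by gcongr
      _ = C₂ * t ^ (-((2 : ℝ) / 2)) := mul_one _
  -- the integrand
  set Φ : ℝ → ℝ := fun t => G t / (1 + Real.log (Real.log (Real.exp 1 + G t)) ^ 2) with hΦ
  have hΦ0 : ∀ t, 0 ≤ G t → 0 ≤ Φ t := fun t ht => by positivity
  have hΦm : AEStronglyMeasurable Φ (volume.restrict (Ioo 0 T)) := by
    have hφ : Measurable fun s : ℝ => s / (1 + Real.log (Real.log (Real.exp 1 + s)) ^ 2) := by
      fun_prop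
    exact (hφ.comp_aemeasurable hGm.aemeasurable).aestronglyMeasurable
  refine ⟨hΦm, ?_⟩
  show ∫⁻ t, ‖Φ t‖ₑ ∂(volume.restrict (Ioo 0 T)) < ∞
  -- the gaps and the weights at the scales
  set I : ℕ → Set ℝ := fun k => Ioc (N (k + 1) ^ 2)⁻¹ (N k ^ 2)⁻¹ with hI
  set t₀ : ℝ := (N 0 ^ 2)⁻¹ with ht₀
  have ht₀0 : 0 < t₀ := by have := hN 0; positivity
  set w : ℕ → ℝ := fun k => 1 / (1 + Real.log (Real.log (Real.exp 1 + N k)) ^ 2) with hw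
  have hw0 : ∀ k, 0 ≤ w k := fun k => by positivity
  have hwle : ∀ k : ℕ, w k ≤ 1 / κ ^ 2 * (1 / ((k : ℝ) + 1) ^ 2) := by
    intro k
    have h := inv_orliczDen_le_of_exp_exp_le (by positivity : 0 < κ * (k + 1)) (hgrow k)
    calc w k ≤ 1 / (κ * (k + 1)) ^ 2 := h
      _ = 1 / κ ^ 2 * (1 / ((k : ℝ) + 1) ^ 2) := by
          field_simp
  -- the gap contributions `b k`
  set K : ℝ := C' * (4 / 3 + 2 * C₂ / c) with hK
  have hK0 : 0 ≤ K := by positivity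
  set b : ℕ → ℝ := fun k => w k * K + (N k)⁻¹ with hb
  have hb0 : ∀ k, 0 ≤ b k := fun k => by have := hN k; positivity
  have hbsum : Summable b := by
    have hs2 : Summable fun k : ℕ => 1 / ((k : ℝ) + 1) ^ 2 := by
      have h := (summable_nat_add_iff 1).mpr (Real.summable_one_div_nat_pow.mpr one_lt_two)
      simpa [Nat.cast_add, Nat.cast_one] using h
    have h1 : Summable fun k : ℕ =>
        1 / κ ^ 2 * (1 / ((k : ℝ) + 1) ^ 2) * K + (N 0)⁻¹ * (1 / 2 : ℝ) ^ k :=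
      ((hs2.mul_left _).mul_right _).add
        ((summable_geometric_of_lt_one (by norm_num) (by norm_num)).mul_left _)
    refine Summable.of_nonneg_of_le hb0 (fun k => ?_) h1
    exact add_le_add (mul_le_mul_of_nonneg_right (hwle k) hK0) (inv_le_of_lacunary hN hlac k)
  -- pointwise bound on a gap
  have hpt : ∀ k, ∀ t ∈ I k ∩ Ioo 0 T, ‖Φ t‖ₑ ≤
      ENNReal.ofReal ((4 / 3 * w k * C' + (N k)⁻¹) * N k ^ 2 +
        w k * C' * C₂ * N (k + 1) ^ 2 * Real.exp (-(c / 2 * N (k + 1) ^ 2 * t))) := by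
    intro k t ht
    have hNk := hN k
    have hNk1 := hN (k + 1)
    have ht0 : 0 < t := ht.2.1
    have hGt := hG0 t ht.2
    rw [Real.enorm_eq_ofReal (hΦ0 t hGt)]
    refine ENNReal.ofReal_le_ofReal ?_
    set E : ℝ := Real.exp (-(c / 2 * N (k + 1) ^ 2 * t)) with hE
    have hE0 : 0 ≤ E := (Real.exp_pos _).le
    have hgt : g t ≤ 4 / 3 * N k ^ 2 + C₂ * N (k + 1) ^ 2 * E :=
      tsum_sq_mul_exp_neg_le_of_gap hN hlac hc hC₂0.le hC₂ k ht.1.1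
    have hGg : G t ≤ C' * g t := hGle t ht.2
    have h1 : Φ t ≤ w k * G t + N k := by
      have h := orliczH_le_threshold hGt hNk.le
      simpa [hΦ, hw, one_div, div_eq_inv_mul, mul_comm] using h
    have h2 : G t ≤ C' * (4 / 3 * N k ^ 2 + C₂ * N (k + 1) ^ 2 * E) :=
      hGg.trans (mul_le_mul_of_nonneg_left hgt hC'0)
    have hwk := hw0 k
    calc Φ t ≤ w k * G t + N k := h1
      _ ≤ w k * (C' * (4 / 3 * N k ^ 2 + C₂ * N (k + 1) ^ 2 * E)) + N k := by gcongr
      _ = (4 / 3 * w k * C' + (N k)⁻¹) * N k ^ 2 +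
          w k * C' * C₂ * N (k + 1) ^ 2 * Real.exp (-(c / 2 * N (k + 1) ^ 2 * t)) := by
          rw [← hE]; field_simp; ring
  -- the gap integrals
  have hk : ∀ k, ∫⁻ t in I k ∩ Ioo 0 T, ‖Φ t‖ₑ ≤ ENNReal.ofReal (b k) := by
    intro k
    have hNk := hN k
    have hNk1 := hN (k + 1)
    have hwk := hw0 k
    calc ∫⁻ t in I k ∩ Ioo 0 T, ‖Φ t‖ₑ
        ≤ ∫⁻ t in I k ∩ Ioo 0 T, ENNReal.ofReal ((4 / 3 * w k * C' + (N k)⁻¹) * N k ^ 2 +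
            w k * C' * C₂ * N (k + 1) ^ 2 * Real.exp (-(c / 2 * N (k + 1) ^ 2 * t))) :=
          setLIntegral_mono' (measurableSet_Ioc.inter measurableSet_Ioo) (hpt k)
      _ ≤ ∫⁻ t in I k, ENNReal.ofReal ((4 / 3 * w k * C' + (N k)⁻¹) * N k ^ 2 +
            w k * C' * C₂ * N (k + 1) ^ 2 * Real.exp (-(c / 2 * N (k + 1) ^ 2 * t))) :=
          lintegral_mono_set inter_subset_left
      _ ≤ ENNReal.ofReal ((4 / 3 * w k * C' + (N k)⁻¹) + w k * C' * C₂ / (c / 2)) :=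
          lintegral_Ioc_const_add_exp_le hNk hNk1 (by positivity) (by positivity) (half_pos hc)
      _ = ENNReal.ofReal (b k) := by
          congr 1
          simp only [hb, hK]
          field_simp
          ring
  -- the bounded piece `[t₀, T)`
  set B : ℝ := C' * (C₂ * t₀ ^ (-((2 : ℝ) / 2))) with hB
  have htail : ∫⁻ t in Ioi t₀ ∩ Ioo 0 T, ‖Φ t‖ₑ ≤ ENNReal.ofReal B * volume (Ioo 0 T) := by
    have h1 : ∀ t ∈ Ioi t₀ ∩ Ioo 0 T, ‖Φ t‖ₑ ≤ ENNReal.ofReal B := by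
      intro t ht
      have ht0 : 0 < t := ht.2.1
      have hGt := hG0 t ht.2
      rw [Real.enorm_eq_ofReal (hΦ0 t hGt)]
      refine ENNReal.ofReal_le_ofReal ?_
      have h2 : G t ≤ C' * (C₂ * t₀ ^ (-((2 : ℝ) / 2))) := by
        refine (hGle t ht.2).trans (mul_le_mul_of_nonneg_left ?_ hC'0)
        refine (hgT t ht0).trans (mul_le_mul_of_nonneg_left ?_ hC₂0.le)
        exact Real.rpow_le_rpow_of_nonpos ht₀0 (le_of_lt ht.1) (by norm_num)
      have h3 : Φ t ≤ G t :=
        div_le_self hGt (by nlinarith [sq_nonneg (Real.log (Real.log (Real.exp 1 + G t)))])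
      exact h3.trans h2
    calc ∫⁻ t in Ioi t₀ ∩ Ioo 0 T, ‖Φ t‖ₑ ≤ ∫⁻ t in Ioi t₀ ∩ Ioo 0 T, ENNReal.ofReal B :=
          setLIntegral_mono' (measurableSet_Ioi.inter measurableSet_Ioo) h1
      _ = ENNReal.ofReal B * volume (Ioi t₀ ∩ Ioo 0 T) := setLIntegral_const _ _
      _ ≤ ENNReal.ofReal B * volume (Ioo 0 T) := by gcongr; exact inter_subset_right
  -- the cover
  have hcover : Ioo 0 T ⊆ (⋃ k, I k ∩ Ioo 0 T) ∪ (Ioi t₀ ∩ Ioo 0 T) := by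
    intro t ht
    rcases le_or_gt t t₀ with h | h
    · obtain ⟨k, hk'⟩ := exists_mem_Ioc_of_lacunary hN hlac ht.1 h
      exact Or.inl (mem_iUnion.2 ⟨k, hk', ht⟩)
    · exact Or.inr ⟨h, ht⟩
  calc ∫⁻ t in Ioo 0 T, ‖Φ t‖ₑ
      ≤ ∫⁻ t in (⋃ k, I k ∩ Ioo 0 T) ∪ (Ioi t₀ ∩ Ioo 0 T), ‖Φ t‖ₑ := lintegral_mono_set hcover
    _ ≤ (∫⁻ t in ⋃ k, I k ∩ Ioo 0 T, ‖Φ t‖ₑ) + ∫⁻ t in Ioi t₀ ∩ Ioo 0 T, ‖Φ t‖ₑ :=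
        lintegral_union_le _ _ _
    _ ≤ (∑' k, ∫⁻ t in I k ∩ Ioo 0 T, ‖Φ t‖ₑ) + ∫⁻ t in Ioi t₀ ∩ Ioo 0 T, ‖Φ t‖ₑ := by
        gcongr
        exact lintegral_iUnion_le _ _
    _ ≤ (∑' k, ENNReal.ofReal (b k)) + ENNReal.ofReal B * volume (Ioo 0 T) :=
        add_le_add (ENNReal.tsum_le_tsum hk) htail
    _ < ∞ := by
        rw [← ENNReal.ofReal_tsum_of_nonneg hb0 hbsum]
        refine ENNReal.add_lt_top.2 ⟨ENNReal.ofReal_lt_top, ?_⟩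
        exact ENNReal.mul_lt_top ENNReal.ofReal_lt_top (by simp [Real.volume_Ioo])

end Main

/-! ## In the vocabulary of `h₂`: the sup norms of a field on `𝕋ⁿ` and of its derivative -/

section Torus

/-- **(5), first bound, for a field with block-type sup bounds** (the shape of Prop. 4.3 /
Lemma 3.2 for the principal part): if `‖v(t, x)‖ ≤ C ∑ₖ N_k e^{-cN_k²t}` on `(0, T) × 𝕋ⁿ` for
scales as above and `t ↦ sup_x ‖v(t,x)‖` is measurable on `(0, T)`, then
`∫₀ᵀ F₂(sup_x ‖v(t,x)‖) dt < ∞` — the first Orlicz clause of `h₂` in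
`construction_of_decomposition`. [cite: CheskidovDaiPalasek2025, Thm. 1.1 (5), Rmk. 1.3] -/
theorem integrableOn_orliczF_iSup_norm_of_lacunary {n : ℕ} (hN : ∀ k, 0 < N k)
    (hlac : ∀ k, 2 * N k ≤ N (k + 1)) {κ : ℝ} (hκ : 0 < κ)
    (hgrow : ∀ k : ℕ, Real.exp (Real.exp (κ * (k + 1))) ≤ N k) {c : ℝ} (hc : 0 < c) {C T : ℝ}
    {v : ℝ → UnitAddTorus (Fin n) → EuclideanSpace ℝ (Fin n)}
    (hvm : AEStronglyMeasurable (fun t => ⨆ x, ‖v t x‖) (volume.restrict (Ioo 0 T)))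
    (hv : ∀ t ∈ Ioo 0 T, ∀ x, ‖v t x‖ ≤ C * ∑' k, N k * Real.exp (-(c * N k ^ 2 * t))) :
    IntegrableOn (fun t : ℝ => (⨆ x, ‖v t x‖) ^ 2 /
      (1 + Real.log (Real.log (Real.exp 1 + ⨆ x, ‖v t x‖)) ^ (2 : ℝ))) (Ioo 0 T) :=
  integrableOn_orliczF_of_le_tsum_lacunary hN hlac hκ hgrow hc hvm
    (fun _ _ => Real.iSup_nonneg fun _ => norm_nonneg _) (fun t ht => ciSup_le fun x => hv t ht x)

/-- **(5), second bound, for a field with block-type derivative bounds**: if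
`‖∇v(t, x)‖ ≤ C ∑ₖ N_k² e^{-cN_k²t}` on `(0, T) × 𝕋ⁿ` for scales as above and
`t ↦ sup_x ‖∇v(t,x)‖` is measurable on `(0, T)`, then `∫₀ᵀ H₂(sup_x ‖∇v(t,x)‖) dt < ∞` — the second
Orlicz clause of `h₂`. [cite: CheskidovDaiPalasek2025, Thm. 1.1 (5), Rmk. 1.3] -/
theorem integrableOn_orliczH_iSup_norm_fderiv_of_lacunary {n : ℕ} (hN : ∀ k, 0 < N k)
    (hlac : ∀ k, 2 * N k ≤ N (k + 1)) {κ : ℝ} (hκ : 0 < κ)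
    (hgrow : ∀ k : ℕ, Real.exp (Real.exp (κ * (k + 1))) ≤ N k) {c : ℝ} (hc : 0 < c) {C T : ℝ}
    {v : ℝ → UnitAddTorus (Fin n) → EuclideanSpace ℝ (Fin n)}
    (hvm : AEStronglyMeasurable (fun t => ⨆ x, ‖FunctionSpaces.Torus.fderiv (v t) x‖)
      (volume.restrict (Ioo 0 T)))
    (hv : ∀ t ∈ Ioo 0 T, ∀ x, ‖FunctionSpaces.Torus.fderiv (v t) x‖ ≤
      C * ∑' k, N k ^ 2 * Real.exp (-(c * N k ^ 2 * t))) :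
    IntegrableOn (fun t : ℝ => (⨆ x, ‖FunctionSpaces.Torus.fderiv (v t) x‖) /
      (1 + Real.log (Real.log (Real.exp 1 +
        ⨆ x, ‖FunctionSpaces.Torus.fderiv (v t) x‖)) ^ (2 : ℝ))) (Ioo 0 T) :=
  integrableOn_orliczH_of_le_tsum_lacunary hN hlac hκ hgrow hc hvm
    (fun _ _ => Real.iSup_nonneg fun _ => norm_nonneg _) (fun t ht => ciSup_le fun x => hv t ht x)

end Torus

end Literature.Barriers.NavierStokesRegularity
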